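import Summits.QuantumAdvantage.QuantumAdvantage.Theses.LinnikCubicClassGroups
import Summits.QuantumAdvantage.QuantumAdvantage.Theorems.LinnikCubicClassGroupsDegreeOnePrimesEscapeCubicEscape
import Summits.QuantumAdvantage.QuantumAdvantage.Theorems.LinnikCubicClassGroupsDegreeOnePrimesEscapeResidueBound
import Summits.QuantumAdvantage.QuantumAdvantage.Theorems.LinnikCubicClassGroupsDegreeOnePrimesEscapePerCharacterDeficitLocal
import Summits.QuantumAdvantage.QuantumAdvantage.Theorems.LinnikCubicClassGroupsDegreeOnePrimesEscapeLowerPIT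
import HarnessLib

/-!
# The crux `DegreeOnePrimesEscape` in EVERY degree from the log-free zero-density estimates —
# the all-degree composition (conditional on explicit density hypotheses; unconditional for `n ≤ 3`)

Topic `Summits/QuantumAdvantage/QuantumAdvantage/Theorems`, helper for the crux `DegreeOnePrimesEscape`
(stmt-QuantumAdvantage-11543) of route `LinnikCubicClassGroups`; cell B2b-1 (linnik-cubic), PART B.
HONEST FRAMING: the value of this file is a THEOREM (a kernel-checked composition pinning the exact
formal debt of the crux) — not summit progress.

The `n = 3` slice of the crux (`LinnikCubicClassGroups.cubicEscape`,
`…PureCubicClassGroupFBQPUnconditional.lean`) is unconditional. This file assembles the crux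
`Summit.QuantumAdvantage.QuantumAdvantage.Theses.LinnikCubicClassGroups.DegreeOnePrimesEscape`
(`∀ n, ∃ C, ∀ K` of degree `n` without quadratic subfield, `∀ x ≥ |d_K|^C`, `∀ M < Cl(𝓞 K)` proper:
`π(x) ≤ 8 · #{P : N P prime ≤ x, [P] ∉ M}`) BY NAME, in every degree, from the per-degree analytic
inputs of line `subgroup-orthogonality-escape`, every other ingredient being a tree theorem:

* `degreeOnePrimesEscape_of_kappaInputs` — from T4(n) (one-sided per-character deficit) and T5(n) (lower
  prime ideal theorem unless a nearby zero), both in `κ`-form at `A = 10`, for every `n ≥ 3`; the residue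
  bound R (`Residue.condQn_rpow_neg_ten_le_residue`, every degree `≥ 2` without quadratic subfield —
  Stark 1974 Lemma 4), Stark's zero-free interval S (`stub_starkNoQuadSubfield n`), the per-field
  composition `CubicEscape.escape_of_inputs` (any `n ≥ 3`) and the degenerate degrees `n ≤ 2`
  (`escape_degenerate`: no field / `h = 1` / `K` is its own quadratic subfield) are discharged inside.
* `degreeOnePrimesEscape_of_logFreeDensities` — from the two LOG-FREE ZERO-DENSITY ESTIMATES in every
  degree `n ≥ 3`: X1(n) for the non-trivial class-group twists (the shape of the tree's
  `logFreeDensity_classGroup n`, tree: `n ≤ 4`) and X2(n) for `ζ₁_K = (s − 1)ζ_K` with the pole term (the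
  shape of `logFreeDensity_dedekindZeta₁`, tree: `n ≤ 3` after `logFreeDensity_dedekindZeta₁_of_le_three`),
  via the degree-local T4 `perCharacterDeficit_of_density_local` and T5 `lowerPIT_of_density_local`.
* `degreeOnePrimesEscape_of_logFreeDensities_beyond` — the same with the hypotheses restricted to the
  degrees the tree does NOT yet cover: X1(n) for `n ≥ 5` and X2(n) for `n ≥ 4`. This is the exact formal
  debt of stmt-QuantumAdvantage-11543 (Weiss 1983 Thm 4.3 / Thorner–Zaman 2019 Thm 3.2 without the
  Deuring–Heilbronn factor, general degree).
* `escape_of_le_three` — UNCONDITIONAL: the body of the crux for every `n ≤ 3`.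

When the all-degree density theorems land (Literature, `…AllDegrees.lean`), the crux closes by the
one-liner `degreeOnePrimesEscape_of_logFreeDensities (fun n _ => X1 n) (fun n _ => X2 n)`.
-/

noncomputable section

open scoped NumberField nonZeroDivisors
open Literature.NumberTheory.LFunctions Literature.NumberTheory.LFunctions.NumberField

namespace Summit.QuantumAdvantage.QuantumAdvantage.Theorems.DegreeOnePrimesEscape

/-! ### Degenerate degrees -/

/-- **Degenerate degrees `n ≤ 2`: the hypotheses of the crux are contradictory** — there is no number
field of degree `0`; in degree `1` the ring of integers is `ℤ`, the class group is trivial and has no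
proper subgroup; in degree `2` the field is its own quadratic subfield. (Verbatim the degenerate branch
of `stub_shadowsComposition`.) -/
theorem escape_degenerate (n : ℕ) (hn : n < 3) (K : Type) [Field K] [NumberField K]
    (hKn : Module.finrank ℚ K = n) (hnq : ∀ F : IntermediateField ℚ K, Module.finrank ℚ F ≠ 2)
    (M : Subgroup (ClassGroup (𝓞 K))) (hM : M ≠ ⊤) : False := by
  interval_cases n
  · exact (Module.finrank_pos (R := ℚ) (M := K)).ne' hKn
  · -- degree one: `𝓞 K ≃ ℤ`, the class group is trivial, so `M = ⊤`
    apply hM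
    have hbij : Function.Bijective (algebraMap ℚ K) :=
      Algebra.finrank_eq_one_iff_bijective_algebraMap.mp hKn
    have : IsIntegralClosure ℤ ℤ K :=
      .of_algEquiv _ (.ofBijective (IsScalarTower.toAlgHom ℤ ℚ K) hbij) (by simp)
    have e : ℤ ≃ₐ[ℤ] 𝓞 K := IsIntegralClosure.equiv ℤ ℤ K (𝓞 K)
    have hPID : IsPrincipalIdealRing (𝓞 K) :=
      IsPrincipalIdealRing.of_surjective (e : ℤ →+* 𝓞 K) e.surjective
    have h1 : NumberField.classNumber K = 1 := (NumberField.classNumber_eq_one_iff).mpr hPID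
    have hsub : Subsingleton (ClassGroup (𝓞 K)) := by
      rw [NumberField.classNumber] at h1
      exact Fintype.card_le_one_iff_subsingleton.mp h1.le
    rw [Subgroup.eq_top_iff']
    intro g
    rw [Subsingleton.elim g 1]
    exact M.one_mem
  · -- degree two: `K` itself is a quadratic subfield
    exact hnq ⊤ (by rw [IntermediateField.finrank_top', hKn])

/-! ### The crux from the `κ`-inputs in every degree -/

/-- **`DegreeOnePrimesEscape` (by name, every degree) from the two `κ`-inputs at `A = 10` in every degree
`n ≥ 3`**: T4(n) — the one-sided per-character deficit `8·Σ_C Re χ(C)·π¹_C(x) ≤ Li(x)` for `x ≥ Q^{C₂}`,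
`χ ≠ 1`, and T5(n) — the dichotomy `29·Li(x) ≤ 32·π_K(x)` or a real zero `β₁ ∈ (1 − 1/(8 log Q), 1)` of
`ζ_K` with `(1 − β₁) log x < 4`, for `x ≥ Q^{C₁}`; both for the fields of degree `n` with `κ_K ≥ Q^{−10}`.
The residue bound `κ_K ≥ Q^{−10}` (R, `Residue.condQn_rpow_neg_ten_le_residue`, Stark 1974 Lemma 4) and
Stark's zero-free interval (S, `stub_starkNoQuadSubfield`) hold for every field without quadratic
subfield and are discharged here; the per-field composition is `CubicEscape.escape_of_inputs`, the
degenerate degrees are `escape_degenerate`. -/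
theorem degreeOnePrimesEscape_of_kappaInputs
    (hD : ∀ n : ℕ, 3 ≤ n → ∃ C₂ : ℝ, ∀ (K : Type) [Field K] [NumberField K], Module.finrank ℚ K = n →
      ThornerZaman.condQn K ^ (-(10 : ℝ)) ≤ NumberField.dedekindZeta_residue K →
      ∀ χ : ClassGroup (𝓞 K) →* ℂˣ, χ ≠ 1 → ∀ x : ℝ, ThornerZaman.condQn K ^ C₂ ≤ x →
        8 * ∑ C : ClassGroup (𝓞 K), ((χ C : ℂ)).re * (degOneClassCount K C x : ℝ) ≤ offsetLogIntegral x)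
    (hL : ∀ n : ℕ, 3 ≤ n → ∃ C₁ : ℝ, ∀ (K : Type) [Field K] [NumberField K], Module.finrank ℚ K = n →
      ThornerZaman.condQn K ^ (-(10 : ℝ)) ≤ NumberField.dedekindZeta_residue K →
      ∀ x : ℝ, ThornerZaman.condQn K ^ C₁ ≤ x →
        29 * offsetLogIntegral x ≤ 32 * (primeIdealCount K x : ℝ) ∨
        ∃ β₁ : ℝ, 1 - 1 / (8 * Real.log (ThornerZaman.condQn K)) < β₁ ∧ β₁ < 1 ∧
          dedekindZetaCont K β₁ = 0 ∧ (1 - β₁) * Real.log x < 4) :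
    Summit.QuantumAdvantage.QuantumAdvantage.Theses.LinnikCubicClassGroups.DegreeOnePrimesEscape := by
  classical
  intro n
  rcases Nat.lt_or_ge n 3 with hn3 | hn3
  · exact ⟨0, fun K _ _ hKn hnq x _ M hM => (escape_degenerate n hn3 K hKn hnq M hM).elim⟩
  · obtain ⟨C₂, hC₂⟩ := hD n hn3
    obtain ⟨C₁, hC₁⟩ := hL n hn3
    obtain ⟨c, hc, hSc⟩ := stub_starkNoQuadSubfield n
    refine ⟨(⌈max (max C₂ C₁) (max 1 (4 / c))⌉₊ + 50) * (1 + n ^ 2) + n, ?_⟩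
    intro K _ _ hKn hnq x hx M hM
    have hκ : ThornerZaman.condQn K ^ (-(10 : ℝ)) ≤ NumberField.dedekindZeta_residue K :=
      Residue.condQn_rpow_neg_ten_le_residue K (by rw [hKn]; omega) hnq
    exact CubicEscape.escape_of_inputs hn3 hc K hKn (fun χ hχ y hy => hC₂ K hKn hκ χ hχ y hy)
      (fun y hy => hC₁ K hKn hκ y hy) (fun σ h1 h2 => hSc K hKn hnq σ h1 h2) x _ rfl hx M hM

/-! ### The crux from the log-free zero-density estimates in every degree -/

open scoped Classical in
/-- **`DegreeOnePrimesEscape` (by name, every degree) from the two log-free zero-density estimates in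
every degree `n ≥ 3`**: X1(n) — for the non-trivial class-group twists `L(s, χ)` of the fields of degree
`n` (verbatim the shape of the tree's `logFreeDensity_classGroup n`), and X2(n) — for
`ζ₁_K = (s − 1)ζ_K` of the fields of degree `n`, pole term included (verbatim the shape of
`logFreeDensity_dedekindZeta₁` / `logFreeDensity_dedekindZeta₁_of_le_three n`). T4(n) and T5(n) are the
degree-local tree theorems `perCharacterDeficit_of_density_local` and `lowerPIT_of_density_local` at
`A = 10`; the rest is `degreeOnePrimesEscape_of_kappaInputs`. -/
theorem degreeOnePrimesEscape_of_logFreeDensities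
    (hX1 : ∀ n : ℕ, 3 ≤ n → ∃ c_D C_D : ℝ, 0 < c_D ∧ 0 < C_D ∧
      ∀ (K : Type) [Field K] [NumberField K], Module.finrank ℚ K = n →
        (∀ χ : ClassGroup (𝓞 K) →* ℂˣ, χ ≠ 1 → ∀ ρ : ℂ, classGroupLFunction₀ K χ ρ = 0 → ρ.re < 1) →
        ∀ P : ℝ, 2 ≤ P → ((NumberField.discr K).natAbs : ℝ) ≤ P →
          (Fintype.card (ClassGroup (𝓞 K)) : ℝ) ≤ P → P⁻¹ ≤ NumberField.dedekindZeta_residue K →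
        ∀ Z : (ClassGroup (𝓞 K) →* ℂˣ) → Finset ℂ,
          (∀ χ : ClassGroup (𝓞 K) →* ℂˣ, χ ≠ 1 → ∀ ρ ∈ Z χ,
              classGroupLFunction₀ K χ ρ = 0 ∧ 1 / 4 ≤ ρ.re ∧ ρ.re < 1 ∧ |ρ.im| ≤ P) →
          ∀ α : ℝ, 0 ≤ α → α ≤ 1 →
            ∑ ψ : AddChar (Additive (ClassGroup (𝓞 K))) ℂ with ψ ≠ 0,
              ∑ ρ ∈ Z (AbelianDensity.toMulHom ψ).toHomUnits with α ≤ ρ.re,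
                (LogFreeLocal.zeroOrder (classGroupLFunction₀ K (AbelianDensity.toMulHom ψ).toHomUnits) ρ : ℝ)
                  ≤ C_D * P ^ (c_D * (1 - α)))
    (hX2 : ∀ n : ℕ, 3 ≤ n → ∃ c_D C_D : ℝ, 0 < c_D ∧ 0 < C_D ∧
      ∀ (K : Type) [Field K] [NumberField K], Module.finrank ℚ K = n →
        ∀ P : ℝ, 2 ≤ P → ((NumberField.discr K).natAbs : ℝ) ≤ P →
          (Fintype.card (ClassGroup (𝓞 K)) : ℝ) ≤ P → P⁻¹ ≤ NumberField.dedekindZeta_residue K →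
        ∀ Z : Finset ℂ, (∀ ρ ∈ Z, dedekindZeta₁ K ρ = 0 ∧ 1 / 4 ≤ ρ.re ∧ ρ.re < 1 ∧ |ρ.im| ≤ P) →
          ∀ α : ℝ, 0 ≤ α → α ≤ 1 →
            ∑ ρ ∈ Z with α ≤ ρ.re, (LogFreeLocal.zeroOrder (dedekindZeta₁ K) ρ : ℝ) ≤
              C_D * P ^ (c_D * (1 - α))) :
    Summit.QuantumAdvantage.QuantumAdvantage.Theses.LinnikCubicClassGroups.DegreeOnePrimesEscape :=
  degreeOnePrimesEscape_of_kappaInputs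
    (fun n hn => perCharacterDeficit_of_density_local n (by omega) (hX1 n hn) 10 (by norm_num))
    (fun n hn => lowerPIT_of_density_local n (by omega) 10 (hX2 n hn))

open scoped Classical in
/-- **The exact formal debt of the crux.** `DegreeOnePrimesEscape` (by name, every degree) from the
log-free zero-density estimates ONLY in the degrees the tree does not yet cover: X1(n) for the class-group
twists in degrees `n ≥ 5` (tree: `logFreeDensity_classGroup n` for `n ≤ 4`) and X2(n) for `ζ₁_K` in
degrees `n ≥ 4` (tree: `logFreeDensity_dedekindZeta₁_of_le_three`). -/
theorem degreeOnePrimesEscape_of_logFreeDensities_beyond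
    (hX1 : ∀ n : ℕ, 5 ≤ n → ∃ c_D C_D : ℝ, 0 < c_D ∧ 0 < C_D ∧
      ∀ (K : Type) [Field K] [NumberField K], Module.finrank ℚ K = n →
        (∀ χ : ClassGroup (𝓞 K) →* ℂˣ, χ ≠ 1 → ∀ ρ : ℂ, classGroupLFunction₀ K χ ρ = 0 → ρ.re < 1) →
        ∀ P : ℝ, 2 ≤ P → ((NumberField.discr K).natAbs : ℝ) ≤ P →
          (Fintype.card (ClassGroup (𝓞 K)) : ℝ) ≤ P → P⁻¹ ≤ NumberField.dedekindZeta_residue K →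
        ∀ Z : (ClassGroup (𝓞 K) →* ℂˣ) → Finset ℂ,
          (∀ χ : ClassGroup (𝓞 K) →* ℂˣ, χ ≠ 1 → ∀ ρ ∈ Z χ,
              classGroupLFunction₀ K χ ρ = 0 ∧ 1 / 4 ≤ ρ.re ∧ ρ.re < 1 ∧ |ρ.im| ≤ P) →
          ∀ α : ℝ, 0 ≤ α → α ≤ 1 →
            ∑ ψ : AddChar (Additive (ClassGroup (𝓞 K))) ℂ with ψ ≠ 0,
              ∑ ρ ∈ Z (AbelianDensity.toMulHom ψ).toHomUnits with α ≤ ρ.re,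
                (LogFreeLocal.zeroOrder (classGroupLFunction₀ K (AbelianDensity.toMulHom ψ).toHomUnits) ρ : ℝ)
                  ≤ C_D * P ^ (c_D * (1 - α)))
    (hX2 : ∀ n : ℕ, 4 ≤ n → ∃ c_D C_D : ℝ, 0 < c_D ∧ 0 < C_D ∧
      ∀ (K : Type) [Field K] [NumberField K], Module.finrank ℚ K = n →
        ∀ P : ℝ, 2 ≤ P → ((NumberField.discr K).natAbs : ℝ) ≤ P →
          (Fintype.card (ClassGroup (𝓞 K)) : ℝ) ≤ P → P⁻¹ ≤ NumberField.dedekindZeta_residue K →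
        ∀ Z : Finset ℂ, (∀ ρ ∈ Z, dedekindZeta₁ K ρ = 0 ∧ 1 / 4 ≤ ρ.re ∧ ρ.re < 1 ∧ |ρ.im| ≤ P) →
          ∀ α : ℝ, 0 ≤ α → α ≤ 1 →
            ∑ ρ ∈ Z with α ≤ ρ.re, (LogFreeLocal.zeroOrder (dedekindZeta₁ K) ρ : ℝ) ≤
              C_D * P ^ (c_D * (1 - α))) :
    Summit.QuantumAdvantage.QuantumAdvantage.Theses.LinnikCubicClassGroups.DegreeOnePrimesEscape := by
  refine degreeOnePrimesEscape_of_logFreeDensities (fun n hn => ?_) (fun n hn => ?_)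
  · by_cases h4 : n ≤ 4
    · exact logFreeDensity_classGroup n h4
    · exact hX1 n (by omega)
  · by_cases h3 : n ≤ 3
    · exact logFreeDensity_dedekindZeta₁_of_le_three n h3
    · exact hX2 n (by omega)

/-! ### Unconditional: every degree `n ≤ 3` -/

/-- **The body of the crux for every degree `n ≤ 3`, UNCONDITIONAL**: for `n ≤ 2` the hypotheses are
contradictory (`escape_degenerate`), and `n = 3` is `CubicEscape.cubicEscape_of_kappaInputs` fed by the
tree theorems R(3) `Residue.residueLowerBound_three`, T4(3) `perCharacterDeficitκ_of_le_four 3` and T5(3)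
`lowerPITκ_three` (the same term as `LinnikCubicClassGroups.cubicEscape`). -/
theorem escape_of_le_three (n : ℕ) (hn : n ≤ 3) :
    ∃ C : ℕ, ∀ (K : Type) [Field K] [NumberField K], Module.finrank ℚ K = n →
      (∀ F : IntermediateField ℚ K, Module.finrank ℚ F ≠ 2) → ∀ x : ℕ, |NumberField.discr K| ^ C ≤ (x : ℤ) →
      ∀ M : Subgroup (ClassGroup (NumberField.RingOfIntegers K)), M ≠ ⊤ →
        Nat.primeCounting x ≤ 8 * Set.ncard {P : Ideal (NumberField.RingOfIntegers K) | P.IsPrime ∧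
          (Ideal.absNorm P).Prime ∧ Ideal.absNorm P ≤ x ∧
          ∃ hP : P ∈ nonZeroDivisors (Ideal (NumberField.RingOfIntegers K)), ClassGroup.mk0 ⟨P, hP⟩ ∉ M} := by
  rcases Nat.lt_or_ge n 3 with hn3 | hn3
  · exact ⟨0, fun K _ _ hKn hnq x _ M hM => (escape_degenerate n hn3 K hKn hnq M hM).elim⟩
  · obtain rfl : n = 3 := le_antisymm hn hn3
    exact CubicEscape.cubicEscape_of_kappaInputs (A := 10) (by norm_num) Residue.residueLowerBound_three
      (perCharacterDeficitκ_of_le_four 3 (by norm_num) (by norm_num) 10 (by norm_num)) (lowerPITκ_three 10)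

end Summit.QuantumAdvantage.QuantumAdvantage.Theorems.DegreeOnePrimesEscape

end
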